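import Mathlib
import Summits.MatrixMultiplication.MatrixMultiplication.Theses.FourierTwoFamiliesModP
import Summits.MatrixMultiplication.MatrixMultiplication.Theorems.FourierTwoFamiliesModPPrimeTwoFamiliesStubPackingTightOfCrux

/-!
# Single-scale kill criterion for `PrimeTwoFamilies` (stub `primeTwoFamilies_false_of_singleScaleDefect`, siege k15)

Crux `stmt-MatrixMultiplication-14308` (`FourierTwoFamiliesModP.PrimeTwoFamilies`: CKSU 2005 Conj. 4.7 with
prime cyclic hosts), line `Sketch`, registered stub `primeTwoFamilies_false_of_singleScaleDefect`.

Statement.  Fix ONE co-volume scale `γ ∈ (0,1)`.  If there is a power defect `c > 0` at that scale — for all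
primes `p ≥ p₀`, every SDPP family `(A i, B i)_{i<n}` in `ZMod p` (clauses (W), (X) of the simultaneous
double product property) with all co-volumes `|A i| |B i| ≥ p ^ γ` has at most `n ≤ p ^ (1 - γ/2 - c)` pairs —
then `PrimeTwoFamilies` is false.

Proof (variation "reduce to landed lemmas of this crux, then assemble").  The landed support theorem
`CapacityLift.stub_packingTightOfCrux` (file `…StubPackingTightOfCrux`, padding by the singleton design +
carry-free transfer) says that the crux forces PACKING-TIGHTNESS AT EVERY SCALE: for every `γ ∈ (0,1)` and
`ε > 0`, arbitrarily large primes `p` carry SDPP families with co-volumes `≥ p ^ γ` and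
`p ^ (1 - γ/2 - ε) ≤ n` pairs.  A defect `c` and tightness at `ε := c/2` are incompatible at any prime
`p ≥ max p₀ 2` (`not_packingTightAt_of_defect`: `p ^ (1-γ/2-c) < p ^ (1-γ/2-c/2)` by strict monotonicity of
`Real.rpow` in the exponent at base `p ≥ 2`).  This generalises the route's kill link `PowerGainRefutes`
(a defect at all scales simultaneously) to the single most convenient scale.
-/

-- single-conjunct summit: the mandated namespace repeats `MatrixMultiplication` (summit = sub-problem).
set_option linter.dupNamespace false

namespace Summit.MatrixMultiplication.MatrixMultiplication.Theorems.PrimeTwoFamilies.SingleScaleDefectK15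

open Summit.MatrixMultiplication.MatrixMultiplication.Theses

/-- **Defect versus tightness at one scale.**  A power defect `c > 0` at co-volume scale `γ` (beyond `p₀`,
every SDPP family in `ZMod p` with co-volumes `≥ p ^ γ` has `n ≤ p ^ (1 - γ/2 - c)` pairs) is incompatible
with packing-tightness at the same scale (for every `ε > 0`, arbitrarily large primes carry such families
with `p ^ (1 - γ/2 - ε) ≤ n`): test tightness at `ε := c/2` and a prime `p ≥ max p₀ 2`, where
`p ^ (1 - γ/2 - c) < p ^ (1 - γ/2 - c/2)`. -/
theorem not_packingTightAt_of_defect {p₀ : ℕ} {γ c : ℝ} (hc : 0 < c)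
    (h : ∀ p : ℕ, p.Prime → p₀ ≤ p → ∀ (n : ℕ) (A B : Fin n → Finset (ZMod p)),
      (∀ i : Fin n, ∀ a ∈ A i, ∀ a' ∈ A i, ∀ b ∈ B i, ∀ b' ∈ B i,
          (a - a') + (b - b') = 0 → a = a' ∧ b = b') →
      (∀ i j k : Fin n, ∀ a ∈ A i, ∀ a' ∈ A j, ∀ b ∈ B j, ∀ b' ∈ B k,
          (a - a') + (b - b') = 0 → i = k) →
      (∀ i : Fin n, (p : ℝ) ^ γ ≤ (((A i).card * (B i).card : ℕ) : ℝ)) →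
      (n : ℝ) ≤ (p : ℝ) ^ (1 - γ / 2 - c))
    (hT : ∀ ε : ℝ, 0 < ε → ∀ p₀ : ℕ, ∃ p ≥ p₀, p.Prime ∧ ∃ (n : ℕ) (A B : Fin n → Finset (ZMod p)),
      (∀ i : Fin n, ∀ a ∈ A i, ∀ a' ∈ A i, ∀ b ∈ B i, ∀ b' ∈ B i,
          (a - a') + (b - b') = 0 → a = a' ∧ b = b') ∧
      (∀ i j k : Fin n, ∀ a ∈ A i, ∀ a' ∈ A j, ∀ b ∈ B j, ∀ b' ∈ B k,
          (a - a') + (b - b') = 0 → i = k) ∧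
      (∀ i : Fin n, (p : ℝ) ^ γ ≤ (((A i).card * (B i).card : ℕ) : ℝ)) ∧
      (p : ℝ) ^ (1 - γ / 2 - ε) ≤ (n : ℝ)) :
    False := by
  obtain ⟨p, hp, hprime, n, A, B, hW, hX, hcov, hn⟩ := hT (c / 2) (by linarith) (max p₀ 2)
  have hle : (n : ℝ) ≤ (p : ℝ) ^ (1 - γ / 2 - c) :=
    h p hprime ((le_max_left _ _).trans hp) n A B hW hX hcov
  have hp2 : (2 : ℝ) ≤ p := by exact_mod_cast (le_max_right _ _).trans hp
  have hlt : (p : ℝ) ^ (1 - γ / 2 - c) < (p : ℝ) ^ (1 - γ / 2 - c / 2) :=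
    Real.rpow_lt_rpow_of_exponent_lt (by linarith) (by linarith)
  linarith [hn.trans hle]

/-- **SINGLE-SCALE KILL CRITERION** (registered stub `primeTwoFamilies_false_of_singleScaleDefect` of crux
`stmt-MatrixMultiplication-14308`).  If at ONE scale `γ ∈ (0,1)` there is a power defect `c > 0` — for all
primes `p ≥ p₀`, every SDPP family in `ZMod p` with all co-volumes `≥ p ^ γ` has `n ≤ p ^ (1 - γ/2 - c)`
pairs — then `PrimeTwoFamilies` is false.  Assembly: the crux is packing-tight at scale `γ`
(`CapacityLift.stub_packingTightOfCrux`, landed), which `not_packingTightAt_of_defect` forbids. -/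
theorem primeTwoFamilies_false_of_singleScaleDefect {γ c : ℝ} (hγ : 0 < γ) (hγ1 : γ < 1) (hc : 0 < c)
    (h : ∃ p₀ : ℕ, ∀ p : ℕ, p.Prime → p₀ ≤ p → ∀ (n : ℕ) (A B : Fin n → Finset (ZMod p)),
      (∀ i : Fin n, ∀ a ∈ A i, ∀ a' ∈ A i, ∀ b ∈ B i, ∀ b' ∈ B i,
          (a - a') + (b - b') = 0 → a = a' ∧ b = b') →
      (∀ i j k : Fin n, ∀ a ∈ A i, ∀ a' ∈ A j, ∀ b ∈ B j, ∀ b' ∈ B k,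
          (a - a') + (b - b') = 0 → i = k) →
      (∀ i : Fin n, (p : ℝ) ^ γ ≤ (((A i).card * (B i).card : ℕ) : ℝ)) →
      (n : ℝ) ≤ (p : ℝ) ^ (1 - γ / 2 - c)) :
    ¬ FourierTwoFamiliesModP.PrimeTwoFamilies := by
  intro hT
  obtain ⟨p₀, hp₀⟩ := h
  exact not_packingTightAt_of_defect hc hp₀
    (Summit.MatrixMultiplication.MatrixMultiplication.Theorems.PrimeTwoFamilies.CapacityLift.stub_packingTightOfCrux
      hT hγ hγ1)

end Summit.MatrixMultiplication.MatrixMultiplication.Theorems.PrimeTwoFamilies.SingleScaleDefectK15
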